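import Summits.RiemannHypothesis.RiemannHypothesis.Theorems.SoninPolyTrace
import HarnessLib

/-!
# The twisted Sonin trace form of a polynomial section vector, II: exponential sums and certificate antiderivatives

Cell `rh-explicit`, seat cc-s2-1 (sub-line (ii), S = {∞, 2}).  Continues `SoninPolyTrace` (generic in the window data
`(p, b)` and the vector data `(r, X)`).  Starting from
`B = ∫₀^{2b} κ(u)(3c(u) − 2e^{−L/2}(c(u+L) + c(|u−L|))) du` with `c = cfun r X` a finite exponential sum, this file
rewrites `B` as a FINITE combination of one-dimensional exponential moments of the kernel polynomial `κ = ev (kappaL p b)`,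
and evaluates those moments by CERTIFICATE ANTIDERIVATIVES:
* `B = Σ_{j<n} WN_j · I(−(2j+1)) − Σ_{i<n} WP_i · I(2i+1)` (`n = |r|`, rational weights `WN_j = Σ_i q_ij X^{i+j+1}`,
  `WP_i = Σ_j q_ij`, `q_ij = 2r_ir_j/(i+j+1)`), where `I(z) = ∫₀^{2b} κ(u) Φ_z(u) du`,
  `Φ_z(u) = 3e^{zu/2} − 2e^{−L/2}(e^{z(u+L)/2} + e^{z|u−L|/2})` (`re_soninTraceForm_eq_weighted_sums`);
* for `L = log 2 ≤ 2b`: `I(z) = 3J(z;0,2b) − 2e^{−L/2}(e^{zL/2}J(z;0,2b) + e^{zL/2}J(−z;0,L) + e^{−zL/2}J(z;L,2b))`,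
  `J(z;lo,hi) = ∫_lo^hi κ(u)e^{zu/2} du` (`Iint_eq`);
* **certificate antiderivatives**: if a list `Q` satisfies `(z/2)·Q + Q′ = κ` coefficientwise (the Boolean check
  `antiderivOK`), then `J(z;lo,hi) = e^{z·hi/2}Q(hi) − e^{z·lo/2}Q(lo)` (FTC; `Jint_eq_of_antiderivOK`).
Part III (`SoninPolyTraceBound`) encloses the resulting expression in fixed-point interval arithmetic.  Definitions:
`expq`, `phiq`, `Jint`, `Iint`, `qcoef`, `WN`, `WP`, `allZeroB`, `eqPolyB`, `antiderivOK` (elementary / bookkeeping).  No facts, no axioms.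
-/

set_option linter.dupNamespace false  -- the mandated namespace repeats `RiemannHypothesis`

noncomputable section

open MeasureTheory Set Finset
open scoped Real
open Summit.RiemannHypothesis.RiemannHypothesis.Theorems.SemilocalPolyWitness
open Summit.RiemannHypothesis.RiemannHypothesis.SoninCert (derivL)
open Literature.NumberTheory.LFunctions Literature.NumberTheory.ConnesConsani2021

namespace Summit.RiemannHypothesis.RiemannHypothesis.SoninPoly

/-! ## Exponential moments of the kernel polynomial -/

/-- `expq z u = e^{zu/2}`. [folklore] -/
def expq (z : ℤ) (u : ℝ) : ℝ := Real.exp ((z : ℝ) * u / 2)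

/-- `Φ_z(u) = 3e^{zu/2} − 2e^{−L/2}(e^{z(u+L)/2} + e^{z|u−L|/2})`, `L = log 2`. [folklore] -/
def phiq (z : ℤ) (u : ℝ) : ℝ :=
  3 * expq z u - 2 * Real.exp (-(Real.log 2 / 2)) * (expq z (u + Real.log 2) + expq z |u - Real.log 2|)

/-- `J(z; lo, hi) = ∫_lo^hi κ(u) e^{zu/2} du` for the kernel list `κL`. [folklore] -/
def Jint (κL : List ℚ) (z : ℤ) (lo hi : ℝ) : ℝ := ∫ u in lo..hi, LQ.ev κL u * expq z u

/-- `I(z) = ∫₀^{2b} κ(u) Φ_z(u) du`. [folklore] -/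
def Iint (κL : List ℚ) (b : ℚ) (z : ℤ) : ℝ := ∫ u in (0 : ℝ)..(2 * b), LQ.ev κL u * phiq z u

/-- `expq z` is continuous. [folklore] -/
theorem continuous_expq (z : ℤ) : Continuous (expq z) := by unfold expq; fun_prop

/-- `phiq z` is continuous. [folklore] -/
theorem continuous_phiq (z : ℤ) : Continuous (phiq z) := by
  unfold phiq
  have h1 := continuous_expq z
  exact (continuous_const.mul h1).sub (continuous_const.mul
    ((h1.comp (continuous_id.add continuous_const)).add (h1.comp ((continuous_id.sub continuous_const).abs))))

/-- `expq z (u + v) = expq z u · expq z v`. [folklore] -/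
theorem expq_add (z : ℤ) (u v : ℝ) : expq z (u + v) = expq z u * expq z v := by
  unfold expq; rw [← Real.exp_add]; ring_nf

/-- `expq z (v − u) = expq z v · expq (−z) u`. [folklore] -/
theorem expq_sub (z : ℤ) (u v : ℝ) : expq z (v - u) = expq z v * expq (-z) u := by
  unfold expq; rw [← Real.exp_add]; push_cast; ring_nf

/-- **Splitting `I(z)` into three exponential moments** (`log 2 ≤ 2b`):
`I(z) = 3J(z;0,2b) − 2e^{−L/2}(e^{zL/2}J(z;0,2b) + e^{zL/2}J(−z;0,L) + e^{−zL/2}J(z;L,2b))`. [folklore] -/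
theorem Iint_eq (κL : List ℚ) {b : ℚ} (hL : Real.log 2 ≤ 2 * (b : ℝ)) (z : ℤ) :
    Iint κL b z = 3 * Jint κL z 0 (2 * b)
      - 2 * Real.exp (-(Real.log 2 / 2)) * (expq z (Real.log 2) * Jint κL z 0 (2 * b)
          + expq z (Real.log 2) * Jint κL (-z) 0 (Real.log 2) + expq (-z) (Real.log 2) * Jint κL z (Real.log 2) (2 * b)) := by
  have hL0 : 0 ≤ Real.log 2 := Real.log_nonneg (by norm_num)
  have hk : Continuous fun u => LQ.ev κL u := LQ.continuous_ev _
  have hI : ∀ (f : ℝ → ℝ), Continuous f → ∀ u v : ℝ, IntervalIntegrable (fun x => LQ.ev κL x * f x) volume u v :=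
    fun f hf u v => (hk.mul hf).intervalIntegrable _ _
  unfold Iint phiq
  have e : ∀ u, LQ.ev κL u * (3 * expq z u - 2 * Real.exp (-((Real.log 2) / 2)) * (expq z (u + (Real.log 2)) + expq z |u - (Real.log 2)|))
      = 3 * (LQ.ev κL u * expq z u) - 2 * Real.exp (-((Real.log 2) / 2)) *
          (expq z (Real.log 2) * (LQ.ev κL u * expq z u) + LQ.ev κL u * expq z |u - (Real.log 2)|) := fun u => by
    rw [expq_add]; ring
  simp_rw [e]
  have iA : IntervalIntegrable (fun u : ℝ => LQ.ev κL u * expq z u) volume 0 (2 * b) :=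
    hI _ (continuous_expq z) _ _
  have iB : IntervalIntegrable (fun u : ℝ => LQ.ev κL u * expq z |u - Real.log 2|) volume 0 (2 * b) :=
    hI _ ((continuous_expq z).comp ((continuous_id.sub continuous_const).abs)) _ _
  rw [intervalIntegral.integral_sub (iA.const_mul 3) (((iA.const_mul _).add iB).const_mul _),
    intervalIntegral.integral_const_mul, intervalIntegral.integral_const_mul,
    intervalIntegral.integral_add (iA.const_mul _) iB, intervalIntegral.integral_const_mul]
  -- the `|u − (Real.log 2)|` moment, split at `(Real.log 2)`
  have hsplit : ∫ u in (0 : ℝ)..(2 * b), LQ.ev κL u * expq z |u - (Real.log 2)|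
      = expq z (Real.log 2) * Jint κL (-z) 0 (Real.log 2) + expq (-z) (Real.log 2) * Jint κL z (Real.log 2) (2 * b) := by
    have hc : Continuous fun u => LQ.ev κL u * expq z |u - (Real.log 2)| :=
      hk.mul ((continuous_expq z).comp ((continuous_id.sub continuous_const).abs))
    rw [← intervalIntegral.integral_add_adjacent_intervals (b := (Real.log 2)) (hc.intervalIntegrable _ _) (hc.intervalIntegrable _ _)]
    have h1 : ∫ u in (0 : ℝ)..(Real.log 2), LQ.ev κL u * expq z |u - (Real.log 2)| = expq z (Real.log 2) * Jint κL (-z) 0 (Real.log 2) := by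
      unfold Jint
      rw [← intervalIntegral.integral_const_mul]
      refine intervalIntegral.integral_congr fun u hu => ?_
      rw [uIcc_of_le hL0] at hu
      rw [abs_of_nonpos (by linarith [hu.2]), neg_sub, expq_sub]; ring
    have h2 : ∫ u in (Real.log 2)..(2 * b), LQ.ev κL u * expq z |u - (Real.log 2)| = expq (-z) (Real.log 2) * Jint κL z (Real.log 2) (2 * b) := by
      unfold Jint
      rw [← intervalIntegral.integral_const_mul]
      refine intervalIntegral.integral_congr fun u hu => ?_
      rw [uIcc_of_le hL] at hu
      rw [abs_of_nonneg (by linarith [hu.1]), expq_sub]; ring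
    rw [h1, h2]
  rw [hsplit]
  unfold Jint
  ring

/-! ## Certificate antiderivatives -/

/-- All coefficients vanish (Boolean; structural recursion, kernel-reducible). [folklore] -/
def allZeroB : List ℚ → Bool
  | [] => true
  | c :: cs => (c == 0) && allZeroB cs

/-- `allZeroB l = true` ⇒ the list polynomial is identically zero. [folklore] -/
theorem ev_eq_zero_of_allZeroB : ∀ (l : List ℚ), allZeroB l = true → ∀ x : ℝ, LQ.ev l x = 0
  | [], _, x => rfl
  | c :: cs, h, x => by
      simp only [allZeroB, Bool.and_eq_true, beq_iff_eq] at h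
      rw [LQ.ev_cons, h.1, ev_eq_zero_of_allZeroB cs h.2 x]; push_cast; ring

/-- Coefficientwise equality of two coefficient lists modulo trailing zeros (Boolean; structural recursion on the
first list, so that the KERNEL can evaluate it — a two-sided recursion would compile to well-founded recursion). [folklore] -/
def eqPolyB : List ℚ → List ℚ → Bool
  | [], l' => allZeroB l'
  | a :: as, [] => (a == 0) && eqPolyB as []
  | a :: as, c :: cs => (a == c) && eqPolyB as cs

/-- `eqPolyB l l' = true` ⇒ the two list polynomials agree as functions. [folklore] -/
theorem ev_eq_of_eqPolyB : ∀ (l l' : List ℚ), eqPolyB l l' = true → ∀ x : ℝ, LQ.ev l x = LQ.ev l' x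
  | [], l', h, x => by
      rw [eqPolyB] at h
      rw [LQ.ev_nil, ev_eq_zero_of_allZeroB l' h x]
  | a :: as, [], h, x => by
      simp only [eqPolyB, Bool.and_eq_true, beq_iff_eq] at h
      rw [LQ.ev_cons, LQ.ev_nil, h.1, ev_eq_of_eqPolyB as [] h.2 x, LQ.ev_nil]; push_cast; ring
  | a :: as, c :: cs, h, x => by
      simp only [eqPolyB, Bool.and_eq_true, beq_iff_eq] at h
      rw [LQ.ev_cons, LQ.ev_cons, h.1, ev_eq_of_eqPolyB as cs h.2 x]

/-- **The antiderivative check**: `(z/2)·Q + Q′ = κ` coefficientwise. [folklore] -/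
def antiderivOK (κL : List ℚ) (z : ℤ) (Q : List ℚ) : Bool :=
  eqPolyB (LQ.add (LQ.smul ((z : ℚ) / 2) Q) (derivL Q)) κL

/-- `antiderivOK` ⇒ the ODE `(z/2)·Q(u) + Q′(u) = κ(u)` for every real `u`. [folklore] -/
theorem ode_of_antiderivOK {κL : List ℚ} {z : ℤ} {Q : List ℚ} (h : antiderivOK κL z Q = true) (u : ℝ) :
    ((z : ℝ) / 2) * LQ.ev Q u + LQ.ev (derivL Q) u = LQ.ev κL u := by
  have := ev_eq_of_eqPolyB _ _ h u
  rw [LQ.ev_add, LQ.ev_smul] at this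
  push_cast at this
  exact this

/-- **Exponential moments by certificate antiderivatives** (FTC): if `(z/2)·Q + Q′ = κ` then
`J(z; lo, hi) = e^{z·hi/2}Q(hi) − e^{z·lo/2}Q(lo)`. [folklore] -/
theorem Jint_eq_of_antiderivOK {κL : List ℚ} {z : ℤ} {Q : List ℚ} (h : antiderivOK κL z Q = true) (lo hi : ℝ) :
    Jint κL z lo hi = expq z hi * LQ.ev Q hi - expq z lo * LQ.ev Q lo := by
  unfold Jint
  have hderiv : ∀ u ∈ uIcc lo hi, HasDerivAt (fun u => expq z u * LQ.ev Q u) (LQ.ev κL u * expq z u) u := by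
    intro u _
    have he : HasDerivAt (expq z) (expq z u * ((z : ℝ) / 2)) u := by
      unfold expq
      have h1 : HasDerivAt (fun u : ℝ => (z : ℝ) * u / 2) ((z : ℝ) / 2) u := by
        simpa using ((hasDerivAt_id u).const_mul (z : ℝ)).div_const 2
      exact (Real.hasDerivAt_exp _).comp u h1
    have hq := hasDerivAt_ev Q u
    refine (he.mul hq).congr_deriv ?_
    rw [← ode_of_antiderivOK h u]
    ring
  have hcont : Continuous fun u => LQ.ev κL u * expq z u := (LQ.continuous_ev _).mul (continuous_expq z)
  rw [intervalIntegral.integral_eq_sub_of_hasDerivAt hderiv (hcont.intervalIntegrable _ _)]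

/-! ## `B` as weighted sums of the moments `I(z)` -/

section Weighted

variable (r : List ℚ) (X : ℚ)

/-- `q_ij = 2 r_i r_j/(i+j+1)`. [folklore] -/
def qcoef (i j : ℕ) : ℚ := 2 * r.getD i 0 * r.getD j 0 / ((i : ℚ) + j + 1)

/-- `WN_j = Σ_i q_ij X^{i+j+1}` — the rational weight of `I(−(2j+1))`. [folklore] -/
def WN (j : ℕ) : ℚ := ∑ i ∈ range r.length, qcoef r i j * X ^ (i + j + 1)

/-- `WP_i = Σ_j q_ij` — the rational weight of `I(2i+1)`. [folklore] -/
def WP (i : ℕ) : ℚ := ∑ j ∈ range r.length, qcoef r i j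

/-- `cfun` in terms of `expq`. [folklore] -/
theorem cfun_eq_expq (s : ℝ) : cfun r X s
    = ∑ i ∈ range r.length, ∑ j ∈ range r.length,
        (qcoef r i j : ℝ) * ((X : ℝ) ^ (i + j + 1) * expq (-(2 * (j : ℤ) + 1)) s - expq (2 * (i : ℤ) + 1) s) := by
  unfold cfun qcoef expq
  refine Finset.sum_congr rfl fun i _ => Finset.sum_congr rfl fun j _ => ?_
  push_cast
  ring_nf

/-- The bracket of `re_soninTraceForm_eq_fold_cfun` as a double sum of `Φ_z`'s. [folklore] -/
theorem bracket_eq_sum_phiq (u : ℝ) :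
    3 * cfun r X u - 2 * Real.exp (-(Real.log 2 / 2)) * (cfun r X (u + Real.log 2) + cfun r X |u - Real.log 2|)
      = ∑ i ∈ range r.length, ∑ j ∈ range r.length,
          (qcoef r i j : ℝ) * ((X : ℝ) ^ (i + j + 1) * phiq (-(2 * (j : ℤ) + 1)) u - phiq (2 * (i : ℤ) + 1) u) := by
  simp only [cfun_eq_expq, phiq]
  rw [Finset.mul_sum, ← Finset.sum_add_distrib, Finset.mul_sum, ← Finset.sum_sub_distrib]
  refine Finset.sum_congr rfl fun i _ => ?_
  rw [Finset.mul_sum, ← Finset.sum_add_distrib, Finset.mul_sum, ← Finset.sum_sub_distrib]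
  refine Finset.sum_congr rfl fun j _ => ?_
  ring

variable {p : List ℚ} {b : ℚ} {X}

/-- **`B` as weighted sums of exponential moments**:
`B = Σ_j WN_j·I(−(2j+1)) − Σ_i WP_i·I(2i+1)` (`0 ≤ b`, `2e^{2b} ≤ X`). [folklore] -/
theorem re_soninTraceForm_eq_weighted_sums (hb : 0 ≤ b) (hX0 : 0 ≤ X) (hX : 2 * Real.exp (2 * b) ≤ X) :
    (soninTraceForm (twistKernel 2 (weilConv (polyWitness p b) (weilReflect (polyWitness p b))))
        (polyEta r hX0 : ℝ → ℂ)).re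
      = ∑ j ∈ range r.length, (WN r X j : ℝ) * Iint (kappaL p b) b (-(2 * (j : ℤ) + 1))
        - ∑ i ∈ range r.length, (WP r i : ℝ) * Iint (kappaL p b) b (2 * (i : ℤ) + 1) := by
  rw [re_soninTraceForm_eq_fold_cfun r hb hX0 hX]
  simp_rw [bracket_eq_sum_phiq r X]
  have hk : Continuous fun u => LQ.ev (kappaL p b) u := LQ.continuous_ev _
  -- distribute the integral over the double sum
  have hterm : ∀ i j : ℕ, Continuous fun u : ℝ => (qcoef r i j : ℝ) *
      ((X : ℝ) ^ (i + j + 1) * phiq (-(2 * (j : ℤ) + 1)) u - phiq (2 * (i : ℤ) + 1) u) := fun i j =>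
    continuous_const.mul ((continuous_const.mul (continuous_phiq _)).sub (continuous_phiq _))
  have e1 : ∀ u, LQ.ev (kappaL p b) u * ∑ i ∈ range r.length, ∑ j ∈ range r.length,
      (qcoef r i j : ℝ) * ((X : ℝ) ^ (i + j + 1) * phiq (-(2 * (j : ℤ) + 1)) u - phiq (2 * (i : ℤ) + 1) u)
      = ∑ i ∈ range r.length, ∑ j ∈ range r.length, LQ.ev (kappaL p b) u *
          ((qcoef r i j : ℝ) * ((X : ℝ) ^ (i + j + 1) * phiq (-(2 * (j : ℤ) + 1)) u - phiq (2 * (i : ℤ) + 1) u)) :=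
    fun u => by rw [Finset.mul_sum]; exact Finset.sum_congr rfl fun i _ => by rw [Finset.mul_sum]
  simp_rw [e1]
  have hI2 : ∀ i j : ℕ, IntervalIntegrable (fun u : ℝ => LQ.ev (kappaL p b) u *
      ((qcoef r i j : ℝ) * ((X : ℝ) ^ (i + j + 1) * phiq (-(2 * (j : ℤ) + 1)) u - phiq (2 * (i : ℤ) + 1) u)))
      volume 0 (2 * b) := fun i j => (hk.mul (hterm i j)).intervalIntegrable _ _
  have hI1 : ∀ i ∈ range r.length, IntervalIntegrable (fun u : ℝ => ∑ j ∈ range r.length, LQ.ev (kappaL p b) u *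
      ((qcoef r i j : ℝ) * ((X : ℝ) ^ (i + j + 1) * phiq (-(2 * (j : ℤ) + 1)) u - phiq (2 * (i : ℤ) + 1) u)))
      volume 0 (2 * b) := fun i _ => (continuous_finsetSum _ fun j _ => hk.mul (hterm i j)).intervalIntegrable _ _
  rw [intervalIntegral.integral_finsetSum hI1]
  have hJ1 : ∀ z : ℤ, IntervalIntegrable (fun u : ℝ => LQ.ev (kappaL p b) u * phiq z u) volume 0 (2 * b) :=
    fun z => (hk.mul (continuous_phiq z)).intervalIntegrable _ _
  have e2 : ∀ i ∈ range r.length, ∫ u in (0 : ℝ)..(2 * b), ∑ j ∈ range r.length, LQ.ev (kappaL p b) u *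
      ((qcoef r i j : ℝ) * ((X : ℝ) ^ (i + j + 1) * phiq (-(2 * (j : ℤ) + 1)) u - phiq (2 * (i : ℤ) + 1) u))
      = ∑ j ∈ range r.length, ((qcoef r i j : ℝ) * (X : ℝ) ^ (i + j + 1) * Iint (kappaL p b) b (-(2 * (j : ℤ) + 1))
          - (qcoef r i j : ℝ) * Iint (kappaL p b) b (2 * (i : ℤ) + 1)) := by
    intro i _
    rw [intervalIntegral.integral_finsetSum (fun j _ => hI2 i j)]
    refine Finset.sum_congr rfl fun j _ => ?_
    unfold Iint
    rw [← intervalIntegral.integral_const_mul, ← intervalIntegral.integral_const_mul,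
      ← intervalIntegral.integral_sub ((hJ1 _).const_mul _) ((hJ1 _).const_mul _)]
    refine intervalIntegral.integral_congr fun u _ => ?_
    ring
  rw [Finset.sum_congr rfl e2]
  -- regroup: Σ_i Σ_j (a_ij - c_ij) = Σ_j (Σ_i a_ij) - Σ_i (Σ_j c_ij)
  simp only [Finset.sum_sub_distrib]
  congr 1
  · rw [Finset.sum_comm]
    refine Finset.sum_congr rfl fun j _ => ?_
    rw [WN]; push_cast; rw [Finset.sum_mul]
  · refine Finset.sum_congr rfl fun i _ => ?_
    rw [WP]; push_cast; rw [Finset.sum_mul]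

end Weighted

end Summit.RiemannHypothesis.RiemannHypothesis.SoninPoly

end
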